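import Literature.AnabelianGeometry.EtaleTheta.Setting
import Mathlib.FieldTheory.Galois.Profinite
import Mathlib.FieldTheory.Galois.Basic
import Mathlib.Topology.Algebra.ClopenNhdofOne
import Mathlib.Topology.Algebra.Category.ProfiniteGrp.Completion
import HarnessLib

/-!
# A model of the [EtTh] §1 root, part C: the arithmetic factor `G_{ℚ_p}` and the fields `K_N`, `J_N`

Mochizuki, *The étale theta function …*, Publ. RIMS **45** (2009) [EtTh], §1, PRIMS PDF pp. 11–14
[cite: MochizukiEtTh2009, §1 p.13]: "`K` a finite extension of `ℚ_p`", "`K_N := K(ζ_N, q_X^{1/N})`",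
"`J_N := K_N(a^{1/N})_{a ∈ K_N}`", and the exact sequences
`1 → (Δ^tp_Y)^ell ⊗ ℤ/Nℤ → Gal(Y_N/Y) → Gal(K_N/K) → 1`, `1 → Δ_Θ ⊗ ℤ/Nℤ → Gal(Z_N/Y_N) → Gal(J_N/K_N) → 1`.
Layer L2 of the abc-iut cell, seat abc-iut-L2-t1 (root owner); THIRD file of the explicit inhabitant of
the L2 root `ThetaSetting p` (vacuity lane — a model is consistency evidence only; see
`SettingModelHeisenberg.lean`).

The model takes `K := ℚ_p` (`⊥`) and `q_X := p`. Contents: (1) every profinite group — in particular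
`G_{ℚ_p}` with its Krull topology — is residually finite as an ABSTRACT group
(`residuallyFinite_of_compact`); (2) the discrete copy `Gam p` of `G_{ℚ_p}` (the model's tempered groups
are discrete), its profinite completion `GamHat p` with the injection `etaGam` and the continuous
retraction `augHatGam : GamHat p → G_{ℚ_p}` extending the identity (the model of `Π_X → G_K`); (3) for
`K = ℚ_p` and any `q ∈ ℚ_p`: the fixing subgroups of `K_N = fieldKN ⊥ q N` and `J_N = fieldJN ⊥ q N`
(`Setting.lean`) are NORMAL in `G_{ℚ_p}` (every `σ` permutes the `N`-th roots of `1` and of `q`),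
`K_1 = ℚ_p`, and `K_M ≤ K_N`, `J_M ≤ J_N` for `M ∣ N` ("`Y_M → Y` may be regarded as a subcovering of
`Y_N → Y`", p. 18). The only instances declared are on the NEW type synonym `Gam p`. Nothing of [EtTh] is
asserted; no side is taken on [IUTchIII] Cor. 3.12.
-/

noncomputable section

namespace Literature.AnabelianGeometry.EtaleTheta.SettingModel

open Literature.AnabelianGeometry.SemiGraphs (GQp)
open CategoryTheory

/-! ### Profinite groups are residually finite (as abstract groups) -/

/-- A compact totally disconnected Hausdorff topological group is residually finite as an abstract
group: a nontrivial element is avoided by some open normal subgroup, which has finite index. (The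
abstract-group fact behind the injectivity of `Π^temp ↪ Π` on the arithmetic factor of the model.)
[cite: MochizukiEtTh2009, §1 p.12] -/
theorem residuallyFinite_of_compact (G : Type*) [Group G] [TopologicalSpace G] [IsTopologicalGroup G]
    [CompactSpace G] [TotallyDisconnectedSpace G] [T2Space G] : Group.ResiduallyFinite G := by
  rw [Group.residuallyFinite_iff_exists_finiteIndexNormalSubgroup]
  intro g hg
  obtain ⟨N, hN⟩ := ProfiniteGrp.exist_openNormalSubgroup_sub_open_nhds_of_one
    (isOpen_compl_singleton (x := g)) (by simpa using hg.symm)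
  exact ⟨N.toFiniteIndexNormalSubgroup, fun h => hN h rfl⟩

section GQp

variable (p : ℕ) [Fact p.Prime]

/-- `G_{ℚ_p}` is compact (Krull topology; `ℚ̄_p/ℚ_p` is Galois). [cite: MochizukiEtTh2009, §1 p.11] -/
theorem compactSpace_GQp : CompactSpace (GQp p) := by
  haveI : IsGalois ℚ_[p] (AlgebraicClosure ℚ_[p]) := {}
  infer_instance

/-- `G_{ℚ_p}` is totally disconnected. [cite: MochizukiEtTh2009, §1 p.11] -/
theorem totallyDisconnectedSpace_GQp : TotallyDisconnectedSpace (GQp p) := by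
  haveI : IsGalois ℚ_[p] (AlgebraicClosure ℚ_[p]) := {}
  infer_instance

/-- **`G_{ℚ_p}` is residually finite** as an abstract group. [cite: MochizukiEtTh2009, §1 p.12] -/
theorem residuallyFinite_GQp : Group.ResiduallyFinite (GQp p) := by
  haveI := compactSpace_GQp p
  haveI : T2Space (GQp p) := krullTopology_t2
  haveI := totallyDisconnectedSpace_GQp p
  exact residuallyFinite_of_compact (GQp p)

/-! ### The discrete copy `Γ` of `G_{ℚ_p}` and its profinite completion -/

/-- `Γ := G_{ℚ_p}` as a DISCRETE group — the arithmetic factor of the model's `Π^tp_X := F₂ × Γ`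
(tempered groups carry a topology finer than the profinite one; the model takes the finest).
[cite: MochizukiEtTh2009, §1 p.12] -/
def Gam : Type := GQp p

/-- [folklore] -/ instance : Group (Gam p) := inferInstanceAs (Group (GQp p))
/-- [folklore] -/ instance : TopologicalSpace (Gam p) := ⊥
/-- [folklore] -/ instance : DiscreteTopology (Gam p) := ⟨rfl⟩

/-- The identity `Γ → G_{ℚ_p}` (continuous: `Γ` is discrete) — the model of the augmentation on the
arithmetic factor. [cite: MochizukiEtTh2009, §1 p.12] -/
def Gam.toGQp : Gam p →ₜ* GQp p where
  toFun σ := σ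
  map_one' := rfl
  map_mul' _ _ := rfl
  continuous_toFun := continuous_of_discreteTopology

/-- [cite: MochizukiEtTh2009, §1 p.12] -/
theorem Gam.toGQp_bijective : Function.Bijective (Gam.toGQp p) := Function.bijective_id

/-- `Γ̂`, the profinite completion of the discrete group `Γ` (the arithmetic factor of the model's
`Π_X`). [cite: MochizukiEtTh2009, §1 p.12] -/
abbrev GamHat : ProfiniteGrp.{0} := ProfiniteGrp.ProfiniteCompletion.completion (GrpCat.of (Gam p))

/-- `η_Γ : Γ → Γ̂`. [cite: MochizukiEtTh2009, §1 p.12] -/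
def etaGam : Gam p →* GamHat p := (ProfiniteGrp.ProfiniteCompletion.eta (GrpCat.of (Gam p))).hom

/-- [cite: MochizukiEtTh2009, §1 p.12] -/
theorem etaGam_apply (σ : Gam p) :
    etaGam p σ = ProfiniteGrp.ProfiniteCompletion.etaFn (GrpCat.of (Gam p)) σ := rfl

/-- **`η_Γ` is injective** (`G_{ℚ_p}` is residually finite). [cite: MochizukiEtTh2009, §1 p.12] -/
theorem etaGam_injective : Function.Injective (etaGam p) := by
  haveI : Group.ResiduallyFinite (Gam p) := residuallyFinite_GQp p
  exact (ProfiniteGrp.ProfiniteCompletion.etaFn_injective_iff_residuallyFinite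
    (GrpCat.of (Gam p))).mpr inferInstance

/-- `G_{ℚ_p}` as an object of `ProfiniteGrp`. [cite: MochizukiEtTh2009, §1 p.11] -/
def GQpProf : ProfiniteGrp.{0} :=
  haveI := compactSpace_GQp p
  haveI := totallyDisconnectedSpace_GQp p
  ProfiniteGrp.of (GQp p)

/-- **`Γ̂ → G_{ℚ_p}`**, the continuous homomorphism extending the identity `Γ → G_{ℚ_p}` (universal
property of the profinite completion) — the model of the profinite augmentation `Π_X → G_K` on the
arithmetic factor. [cite: MochizukiEtTh2009, §1 p.12] -/
def augHatGam : GamHat p →ₜ* GQp p :=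
  (ProfiniteGrp.ProfiniteCompletion.lift (P := GQpProf p)
    (GrpCat.ofHom (Gam.toGQp p).toMonoidHom)).hom

/-- `augHatGam ∘ η_Γ = id`. [cite: MochizukiEtTh2009, §1 p.12] -/
theorem augHatGam_etaGam (σ : Gam p) : augHatGam p (etaGam p σ) = Gam.toGQp p σ := by
  have h := ConcreteCategory.congr_hom (ProfiniteGrp.ProfiniteCompletion.lift_eta (P := GQpProf p)
    (GrpCat.ofHom (Gam.toGQp p).toMonoidHom)) σ
  exact h

end GQp

/-! ### The fields `K_N`, `J_N` over `K = ℚ_p`: normality and monotonicity -/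

section Fields

variable {p : ℕ} [Fact p.Prime] (q : PadicAlgCl p)
  (hq : q ∈ (⊥ : IntermediateField ℚ_[p] (PadicAlgCl p)))

/-- A subset of `ℚ̄_p` stable under `σ` and `σ⁻¹` is carried onto itself by `σ`. [folklore] -/
private theorem image_eq_of_stable (σ : GQp p) (S : Set (PadicAlgCl p))
    (h : ∀ τ : GQp p, ∀ x ∈ S, τ x ∈ S) : σ '' S = S := by
  refine Set.Subset.antisymm ?_ fun x hx => ⟨σ.symm x, h σ.symm x hx, σ.apply_symm_apply x⟩
  rintro _ ⟨x, hx, rfl⟩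
  exact h σ x hx

include hq in
/-- Every `σ ∈ G_{ℚ_p}` fixes `q ∈ ℚ_p`. [folklore] -/
private theorem apply_q (σ : GQp p) : σ q = q := by
  obtain ⟨c, rfl⟩ := IntermediateField.mem_bot.mp hq
  exact σ.commutes c

include hq in
/-- `σ(K_N) = K_N`: every `σ ∈ G_{ℚ_p}` permutes the `N`-th roots of unity and the `N`-th roots of
`q ∈ ℚ_p` ("`K_N := K(ζ_N, q_X^{1/N})`", [EtTh] p. 13). [cite: MochizukiEtTh2009, §1 p.13] -/
theorem map_fieldKN_bot (σ : GQp p) (N : ℕ+) :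
    (fieldKN ⊥ q N).map (σ : PadicAlgCl p →ₐ[ℚ_[p]] PadicAlgCl p) = fieldKN ⊥ q N := by
  unfold fieldKN
  rw [IntermediateField.adjoin_map]
  congr 1
  refine image_eq_of_stable σ _ fun τ x hx => ?_
  rcases hx with hx | hx
  · left
    obtain ⟨c, rfl⟩ := IntermediateField.mem_bot.mp hx
    rw [SetLike.mem_coe, AlgEquiv.commutes]
    exact (⊥ : IntermediateField ℚ_[p] (PadicAlgCl p)).algebraMap_mem c
  · right
    rcases hx with hx | hx
    · left; rw [← map_pow, hx, map_one]
    · right; rw [← map_pow, hx, apply_q q hq τ]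

include hq in
/-- `σ x ∈ K_N` for `x ∈ K_N`. [cite: MochizukiEtTh2009, §1 p.13] -/
theorem apply_mem_fieldKN_bot (σ : GQp p) (N : ℕ+) {x : PadicAlgCl p} (hx : x ∈ fieldKN ⊥ q N) :
    σ x ∈ fieldKN ⊥ q N := by
  have : σ x ∈ (fieldKN ⊥ q N).map (σ : PadicAlgCl p →ₐ[ℚ_[p]] PadicAlgCl p) := ⟨x, hx, rfl⟩
  rwa [map_fieldKN_bot q hq σ N] at this

include hq in
/-- **`G_{K_N}` is normal in `G_{ℚ_p}`** (`K_N/ℚ_p` is Galois: "`Gal(K_N/K)`", [EtTh] p. 13).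
[cite: MochizukiEtTh2009, §1 p.13] -/
theorem fixingSubgroup_fieldKN_bot_normal (N : ℕ+) : (fieldKN ⊥ q N).fixingSubgroup.Normal :=
  Subgroup.Normal.of_conjugate_fixed fun σ => by
    rw [← IsGalois.map_fixingSubgroup, map_fieldKN_bot q hq σ N]

/-- `K_N ≤ J_N` ("`J_N := K_N(a^{1/N})_{a ∈ K_N}`", p. 14). [cite: MochizukiEtTh2009, §1 p.14] -/
theorem fieldKN_le_fieldJN (K : IntermediateField ℚ_[p] (PadicAlgCl p)) (N : ℕ+) :
    fieldKN K q N ≤ fieldJN K q N :=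
  fun _ hx => IntermediateField.subset_adjoin _ _ (Or.inl hx)

include hq in
/-- `σ(J_N) = J_N` for `σ ∈ G_{ℚ_p}` (p. 14). [cite: MochizukiEtTh2009, §1 p.14] -/
theorem map_fieldJN_bot (σ : GQp p) (N : ℕ+) :
    (fieldJN ⊥ q N).map (σ : PadicAlgCl p →ₐ[ℚ_[p]] PadicAlgCl p) = fieldJN ⊥ q N := by
  unfold fieldJN
  rw [IntermediateField.adjoin_map]
  congr 1
  refine image_eq_of_stable σ _ fun τ x hx => ?_
  rcases hx with hx | hx
  · exact Or.inl (apply_mem_fieldKN_bot q hq τ N hx)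
  · right
    show (τ x) ^ (N : ℕ) ∈ fieldKN ⊥ q N
    rw [← map_pow]
    exact apply_mem_fieldKN_bot q hq τ N hx

include hq in
/-- **`G_{J_N}` is normal in `G_{ℚ_p}`** ("`Gal(Z_N/X)`", [EtTh] p. 15). [cite: MochizukiEtTh2009, §1 p.14] -/
theorem fixingSubgroup_fieldJN_bot_normal (N : ℕ+) : (fieldJN ⊥ q N).fixingSubgroup.Normal :=
  Subgroup.Normal.of_conjugate_fixed fun σ => by
    rw [← IsGalois.map_fixingSubgroup, map_fieldJN_bot q hq σ N]

include hq in
/-- `K_1 = K` ("`Y = Y_1`", p. 14): for `K = ℚ_p`, `fieldKN ⊥ q 1 = ⊥`. [cite: MochizukiEtTh2009, §1 p.14] -/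
theorem fieldKN_bot_one : fieldKN ⊥ q 1 = ⊥ := by
  unfold fieldKN
  refine le_antisymm (IntermediateField.adjoin_le_iff.mpr ?_) bot_le
  rintro x (hx | hx)
  · exact hx
  · simp only [PNat.one_coe, pow_one, Set.mem_setOf_eq] at hx
    rcases hx with rfl | rfl
    · exact (⊥ : IntermediateField ℚ_[p] (PadicAlgCl p)).one_mem
    · exact hq

/-- **`K_M ≤ K_N` for `M ∣ N`** ("`Y_M → Y` may be regarded as a subcovering of `Y_N → Y`", p. 18): an
`M`-th root of `q` is an `N`-th root of `q` to the power `N/M` times an `N`-th root of unity.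
[cite: MochizukiEtTh2009, §1 p.18] -/
theorem fieldKN_bot_mono (hq0 : q ≠ 0) {M N : ℕ+} (h : (M : ℕ) ∣ N) :
    fieldKN ⊥ q M ≤ fieldKN ⊥ q N := by
  obtain ⟨k, hk⟩ := h
  unfold fieldKN
  refine IntermediateField.adjoin_le_iff.mpr ?_
  rintro x (hx | hx)
  · exact IntermediateField.subset_adjoin _ _ (Or.inl hx)
  · rcases hx with hx | hx
    · exact IntermediateField.subset_adjoin _ _ (Or.inr (Or.inl (by rw [hk, pow_mul, hx, one_pow])))
    · obtain ⟨y, hy⟩ := IsAlgClosed.exists_pow_nat_eq q N.pos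
      have hy0 : y ≠ 0 := by
        rintro rfl
        exact hq0 (by rw [← hy, zero_pow N.ne_zero])
      have hyK : y ∈ IntermediateField.adjoin ℚ_[p]
          (((⊥ : IntermediateField ℚ_[p] (PadicAlgCl p)) : Set (PadicAlgCl p)) ∪
            {x | x ^ (N : ℕ) = 1 ∨ x ^ (N : ℕ) = q}) :=
        IntermediateField.subset_adjoin _ _ (Or.inr (Or.inr hy))
      have hz : (x / y ^ k) ^ (N : ℕ) = 1 := by
        rw [div_pow, ← pow_mul, mul_comm k (N : ℕ), pow_mul, hy, hk, pow_mul, hx]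
        exact div_self (pow_ne_zero k hq0)
      have hzK : x / y ^ k ∈ IntermediateField.adjoin ℚ_[p]
          (((⊥ : IntermediateField ℚ_[p] (PadicAlgCl p)) : Set (PadicAlgCl p)) ∪
            {x | x ^ (N : ℕ) = 1 ∨ x ^ (N : ℕ) = q}) :=
        IntermediateField.subset_adjoin _ _ (Or.inr (Or.inl hz))
      have hxz : x = x / y ^ k * y ^ k := by rw [div_mul_cancel₀ _ (pow_ne_zero _ hy0)]
      rw [hxz]
      exact mul_mem hzK (pow_mem hyK k)

/-- **`J_M ≤ J_N` for `M ∣ N`** ("`Z_M → Y` … a subcovering of `Z_N → Y`", p. 18).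
[cite: MochizukiEtTh2009, §1 p.18] -/
theorem fieldJN_bot_mono (hq0 : q ≠ 0) {M N : ℕ+} (h : (M : ℕ) ∣ N) :
    fieldJN ⊥ q M ≤ fieldJN ⊥ q N := by
  have hKN := fieldKN_bot_mono q hq0 h
  obtain ⟨k, hk⟩ := h
  unfold fieldJN
  refine IntermediateField.adjoin_le_iff.mpr ?_
  rintro x (hx | hx)
  · exact IntermediateField.subset_adjoin _ _ (Or.inl (hKN hx))
  · refine IntermediateField.subset_adjoin _ _ (Or.inr ?_)
    show x ^ (N : ℕ) ∈ fieldKN ⊥ q N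
    rw [hk, pow_mul]
    exact hKN (pow_mem hx k)

end Fields

end Literature.AnabelianGeometry.EtaleTheta.SettingModel

end
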